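/-
Copyright (c) 2026 the pub-hodgecm-mathlib formalisation cell (harness21).  Prover seat hodgecm-mathlib-LH7-p10 (g2), req620 Track A «(D-RAM) FOUR-FRAME» squad
((β₂) road (R-36) «PURE-CELL LEDGER», lane C = type RamM: the twin of LH4-p13 (g9)'s ★ `F0P3cDyRamTopConeCellMid` — the MIDDLE band (and the general below-the-digit head) of
the `hTopC` socket of LH4-p12 (g8)'s ★ p863526 (OFF_C) dispatch), 2026-09-05.
-/
import Summits.HodgeConjecture.HodgeConjecture.Theorems.F0P3cDyRamTopConeCellMid              -- ★ (LH4-p13 (g9)): §1 `mapGL_eq_of_latticeInLevel`, `v_det_endoGL_eq_one` (Γ-fixedness from the level token; E-side, lane-agnostic)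
import Summits.HodgeConjecture.HodgeConjecture.Theorems.F0P3cDyRamTopConeCellEmptyRamM        -- (this seat, prequel): the fold `levelSetDep_inter_shell_eq_empty_of_top_ramM`; brings `…TopConeCellOffShellRamM`, ★ p862869 junction
import Summits.HodgeConjecture.HodgeConjecture.Theorems.F0P3cDyRamCleanLevelOfKernelCHBlock   -- ★ p861941 (LH4-p04 (g8)): (α′)₂ `latticeInLevel_sq_endoGL_of_shell_of_valueSet_eq_of_formCongr`
import HarnessLib

/-!
# Crux `H413`, line LH4 «(D-RAM) FOUR-FRAME» — the (β₂) road (R-36), lane C (type RamM), socket `hTopC` of LH4-p12 (g8)'s (OFF_C) dispatch ★ p863526, MIDDLE BAND: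
# «A MIDDLE-BAND TOP-LINE CONE CELL OF THE RamM LEDGER CONTRIBUTES ZERO» — `2b + m⋆ ≤ m < 2b + m_c` on the line `jl + 2b = 2j + d_ρ + m`: the `−′` subset is empty by the
# square digit at `m_c` (`…TopConeCellOffShellRamM`), the `+` subset because a `+` label on the `(ℓ₀, m⋆)`-shell forces the square token at `m_c` ((α′)₂, ★ p861941) — which
# the same digit denies

Cell `hodgecm-mathlib` (D-0151), FLOOR 0, crux item H413 = `stmt-HodgeConjecture-24833`, route of record `HCCMUnconditional`; squads F0∕P3c∕LH4 + LH7; lane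
`--supports stmt-HodgeConjecture-24833 --as helper` (count-neutral; pays NO tier-0 row).  THEOREMS ONLY (no `def`, no instance, no notation, no `sorry`, default heartbeats);
★-only imports; states NO law; (β₂) stays a HYPOTHESIS.  DATUM-FREE: ★ p861044∕p861305's block frame in the GENERAL-BLOCK spelling `(H₂, h_W, P₁, γ₂, φ, h, f)` of ‹OFF_C.letter.v2›
(so one theorem serves both literals), the line model with `jE` RAMIFIED (`c1 : |jE a| = |a|²`; the RamM place package's `c5 c6 c7`: `|α − ρα| = exp(−d_ρ)`), the ramified datum `hD`
on `E`, ★ DEFS `levelSetDep`.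

WHY (LH4-p12 (g8)'s ★ p863526, socket `hTopC`; this seat's ✋ 00:25:10Z; lane B: β₂ WORD #12, LH4-p13 (g9)'s ★ `cellDiff_topMid_eq_zero`).  On the middle band the vertex CAN sit
on the `(ℓ₀, m⋆)`-shell (the digit of `…TopConeCellOffShellRamM` only bites at `m < 2b + k`), so «off-shell» is not available for the `+` label; instead, exactly as in lane B:
Γ-FIXEDNESS of the presented vertex from its level token (★ `…TopConeCellMid.mapGL_eq_of_latticeInLevel`, `|det ι(γ₂, u)| = 1` by ★ `v_det_endoGL_eq_one`), then (α′)₂ ★ p861941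
(type 0 = self-dual, Γ-fixed, `hs hp`) gives `LatticeInLevel ϖ m_c ((Γ−1)²) L₃`, contradicting `not_latticeInLevel_sq_endoGL_sub_one_of_top_ramM` at `k = m_c` (`m < 2b + m_c`,
`|ν| ≤ |jE ϖ|^{m_c}` from the fence `2m_c ≤ m`, `hum`, `|2| = |ϖ|^{t_E}`, `m_c ≤ m⋆ + t_E`); the `−′` subset is `∅` by the fold at `k = m_c`; both finsums vanish.
* HEAD `cellDiff_top_eq_zero_ramM` — GENERAL (`1 ≤ b`, `jl + 2b = 2j + d_ρ + m`, `m < 2b + m_c`, `lam ∈ 𝒪_j`: HIGH + MID bands and the `j = b` end below the digit), letters in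
  ‹OFF_C›'s names preceded by the context letters `2m_c ≤ m` (fence), the unitary frame `P₁ hA hΓ`, `hdet hu`, `hs hp` of the ‹OFF_C› block.
* (U-mid)_C `cellDiff_topMid_eq_zero_ramM` — LH4-p12's `hTopC` letters positionally (`1 ≤ b`, `b ≤ j`, `m < 4b`, the line, `2b + m⋆ ≤ m`, `m < 2b + m_c`, `lam ∈ 𝒪_j`).
HONEST LABEL.  Count-neutral lattice bookkeeping; nothing printed is asserted; the LOW band `2b + m_c ≤ m` (labelled, balanced) is NOT here; `HC_CM` is proved only modulo the 7
printed citations (2 remaining named inputs: hLiu418 = `stmt-HodgeConjecture-24832`, h413 = `stmt-HodgeConjecture-24833`) until rung 0 closes.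
## References
* [Kottwitz1986BaseChangeUnits] R. E. Kottwitz, *Base change for unit elements of Hecke algebras*, Compositio Math. 60 (1986): §1 pp. 240–241 (congruence-level pieces as lattice conditions).
* [Serre1980Trees] J.-P. Serre, *Trees*, Springer (1980): Ch. II §1.1 (the stabiliser of a lattice).
* [Jacobowitz1962] R. Jacobowitz, *Hermitian forms over local fields*, Amer. J. Math. 84 (1962): §4, §7 (unimodular lattices).
* [Rogawski1990] J. D. Rogawski, *Automorphic Representations of Unitary Groups in Three Variables*, Ann. of Math. Stud. 123 (1990): §4.8 Case (a) p. 53; §4.9 Prop. 4.9.1 (b) p. 55.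
-/

set_option autoImplicit false

noncomputable section

namespace Summit.HodgeConjecture.HodgeConjecture.Cruxes.H413.F0P3cDyRamTopConeCellMidRamM

open scoped Valued WithZero Matrix MatrixGroups
open WithZero
open Literature.NumberTheory.Automorphic Literature.NumberTheory.Automorphic.HermitianLattice Literature.NumberTheory.Automorphic.UnitaryLatticeTree
open Literature.NumberTheory.Automorphic.UnitaryGroup
open Literature.NumberTheory.Automorphic.UnitaryThreeFourFrame (IsRamifiedQuadraticDatum)
open Literature.NumberTheory.LocalFields.WildQuadraticDatum (d_le_succ_t)
open Literature.NumberTheory.Rogawski1990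
open Summit.HodgeConjecture.HodgeConjecture.Cruxes.H413.F0P3cDyRamToricCensusDefs
open Summit.HodgeConjecture.HodgeConjecture.Cruxes.H413.F0P3cDyRamFourFramePieces
open Summit.HodgeConjecture.HodgeConjecture.Cruxes.H413.F0P3cDyRamFourFrameCensusDefs (LatticeInLevel LatticeNearTransvShell)
open Summit.HodgeConjecture.HodgeConjecture.Cruxes.H413.F0P3cDyRamStageOneBDefs (mcOfRecord mstarOfRecord_le_mcOfRecord)
open Summit.HodgeConjecture.HodgeConjecture.Cruxes.H413.F0P3cDyRamConeCellPresentation (exists_presentation_of_mem_levelSetDep)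
open Summit.HodgeConjecture.HodgeConjecture.Cruxes.H413.F0P3cDyRamTopConeCellOffShellRamM (not_latticeInLevel_sq_endoGL_sub_one_of_top_ramM)
open Summit.HodgeConjecture.HodgeConjecture.Cruxes.H413.F0P3cDyRamTopConeCellEmptyRamM (levelSetDep_inter_shell_eq_empty_of_top_ramM)
open Summit.HodgeConjecture.HodgeConjecture.Cruxes.H413.F0P3cDyRamTopConeCellMid (mapGL_eq_of_latticeInLevel v_det_endoGL_eq_one)
open Summit.HodgeConjecture.HodgeConjecture.Cruxes.H413.F0P3cDyRamCleanLevelOfKernelCHBlock (latticeInLevel_sq_endoGL_of_shell_of_valueSet_eq_of_formCongr)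

variable {E M : Type} [Field E] [Valued E ℤᵐ⁰] [Field M] [Valued M ℤᵐ⁰] {ρ Θ : M →+* M} {α : M}

/-! ## §2 HEAD — the middle band of socket `hTopC` at the cell, in ‹OFF_C.letter.v2›'s one-literal currency -/

/-- **«A TOP-LINE CONE CELL OF THE RamM LEDGER BELOW THE `m_c`-DIGIT CONTRIBUTES ZERO» — GENERAL HEAD** (covers the HIGH and MIDDLE bands AND the diagonal end `j = b`; minimal
letters after the context letters `hmcm : 2m_c ≤ m`, `P₁ hA hΓ`, `hdet hu`, `hs hp`): `1 ≤ b`, `jl + 2b = 2j + d_ρ + m`, `m < 2b + m_c`, `lam ∈ 𝒪_j` ⟹ `cellDiff(j, b) = 0` (no `b < j`, no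
`m < 4b`, no lower band edge).  The `−′` subset is `∅` (square digit of `…TopConeCellOffShellRamM` at `k = m_c`, via the fold `levelSetDep_inter_shell_eq_empty_of_top_ramM`); the
`+` subset is `∅` since a presented vertex (★ junction) on the `(ℓ₀, m⋆)`-shell with `VS = V₊` is Γ-fixed (★ `mapGL_eq_of_latticeInLevel`, `|det ι(γ₂,u)| = 1`) and self-dual, so
(α′)₂ ★ p861941 puts `(Γ − 1)²` in level `m_c` on it — against the digit at `k = m_c`.  Lane-C letters: `c1 : |jE a| = |a|²`, `c5 c6 c7` (`|α − ρα| = exp(−d_ρ)`) replace lane B's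
`hjiso`, `hU`. [cite: Kottwitz1986BaseChangeUnits, §1 pp. 240–241] [cite: Rogawski1990, §4.9 Prop. 4.9.1 (b) p. 55] [cite: Jacobowitz1962, §4, §7] -/
theorem cellDiff_top_eq_zero_ramM
    (σ : E →+* E) {ϖ : E} {d tE : ℕ} (hD : IsRamifiedQuadraticDatum σ ϖ d tE)
    {H₂ : Matrix (Fin 2) (Fin 2) E} (hH₂ : IsUnit H₂.det) (hH₂σ : (H₂.map σ)ᵀ = H₂) {hW : E} (hhW : Valued.v hW = 1)
    (jE : E →+* M) (hρρ : ∀ x, ρ (ρ x) = x) (hvρ : ∀ x, Valued.v (ρ x) = Valued.v x) (hα : ρ α ≠ α) (hα1 : Valued.v α ≤ 1)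
    (hint : ∀ z : M, Valued.v z ≤ 1 → Valued.v ((z - ρ z) / (α - ρ α)) ≤ 1)
    (hΘΘ : ∀ x, Θ (Θ x) = x) (hΘρ : ∀ x, Θ (ρ x) = ρ (Θ x)) (hvΘ : ∀ x, Valued.v (Θ x) = Valued.v x)
    (hjv : ∀ c, Valued.v (jE c) ≤ 1 ↔ Valued.v c ≤ 1) (hjfix : ∀ z, ρ z = z ↔ ∃ c, jE c = z)
    (hjpow : ∀ (t : E) (n : ℤ), Valued.v (jE t) = Valued.v (jE ϖ) ^ n ↔ Valued.v t = Valued.v ϖ ^ n)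
    (hϖmax : ∀ t : M, ρ t = t → Valued.v t < 1 → Valued.v t ≤ Valued.v (jE ϖ))
    (c1 : ∀ a, Valued.v (jE a) = Valued.v a ^ 2) {ϖM : M} {dρ : ℕ} (c5 : Valued.v ϖM = WithZero.exp (-1 : ℤ)) (c6 : α - ρ α = ϖM - ρ ϖM)
    (c7 : IsRamifiedQuadraticDatum ρ ϖM dρ (2 * tE))
    (φ : (Fin 2 → E) →+ M) (hφs : ∀ (c : E) (x : Fin 2 → E), φ (c • x) = jE c * φ x) (hφi : Function.Injective φ) (hφo : Function.Surjective φ)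
    {γ₂ : GL (Fin 2) E} {lam h : M} (hφγ : ∀ x, φ ((γ₂ : Matrix (Fin 2) (Fin 2) E).mulVec x) = lam * φ x) (hlam : Valued.v lam = 1)
    (hΘh : Θ h = h) (hh : h ≠ 0) (hform : ∀ x y, jE (pairing σ H₂ x y) = h * Θ (φ x) * φ y + ρ (h * Θ (φ x) * φ y))
    (u : GL (Fin 1) E) (hum : Valued.v (((u : Matrix (Fin 1) (Fin 1) E) 0 0) - 1) ≤ Valued.v (ϖ ^ mstarOfRecord d))
    {m jl : ℕ} (hm : Valued.v (lam - jE ((u : Matrix (Fin 1) (Fin 1) E) 0 0)) = WithZero.exp (-(m : ℤ)))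
    (hjl : Valued.v ((lam - jE ((u : Matrix (Fin 1) (Fin 1) E) 0 0)) - ρ (lam - jE ((u : Matrix (Fin 1) (Fin 1) E) 0 0))) = WithZero.exp (-(jl : ℤ)))
    (f : ℕ → ℕ → AddSubgroup M → ℕ) (hmcm : 2 * mcOfRecord d ≤ m)
    (P₁ : GL (Fin 3) E) (hA : formCongr σ P₁ ((StdForm.antidiagonal 3).over E) = (!![H₂ 0 0, 0, H₂ 0 1; 0, hW, 0; H₂ 1 0, 0, H₂ 1 1] : Matrix (Fin 3) (Fin 3) E))
    (hΓ : P₁ * endoGL (γ₂, u) * P₁⁻¹ ∈ unitaryGroupOfForm σ ((StdForm.antidiagonal 3).over E))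
    (hdet : (γ₂ : Matrix (Fin 2) (Fin 2) E).det * σ (γ₂ : Matrix (Fin 2) (Fin 2) E).det = 1) (hu : Valued.v ((u : Matrix (Fin 1) (Fin 1) E) 0 0) = 1)
    (hs : Valued.v ((γ₂ : Matrix (Fin 2) (Fin 2) E).trace - 2) * Valued.v (ϖ ^ (d % 2)) ≤ Valued.v (ϖ ^ mcOfRecord d))
    (hp : Valued.v ((γ₂ : Matrix (Fin 2) (Fin 2) E).det - (γ₂ : Matrix (Fin 2) (Fin 2) E).trace + 1) ≤ Valued.v (ϖ ^ mcOfRecord d))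
    (j b : ℕ) (hb1 : 1 ≤ b) (hline : jl + 2 * b = 2 * j + dρ + m) (hband2 : m < 2 * b + mcOfRecord d) (hlamj : IsOrd ρ α (jE ϖ ^ j) lam) :
    ((∑ᶠ Λ ∈ levelSetDep ρ Θ α (jE ϖ) h j b (lam - jE ((u : Matrix (Fin 1) (Fin 1) E) 0 0)) ∩
                      {Λ | ∃ B : Submodule 𝒪[E] (Fin 2 → E), B.toAddSubgroup.map φ = Λ ∧
                        ∃ L₃ : Submodule 𝒪[E] (Fin 3 → E), IsSelfDualLattice σ ϖ (!![H₂ 0 0, 0, H₂ 0 1; 0, hW, 0; H₂ 1 0, 0, H₂ 1 1] : Matrix (Fin 3) (Fin 3) E) L₃ ∧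
                          L₃ ⊓ LinearMap.ker ((LinearMap.proj (1 : Fin 3) : (Fin 3 → E) →ₗ[E] E).restrictScalars 𝒪[E]) =
                            B.map ((Matrix.toLin' (!![1, 0; 0, 0; 0, 1] : Matrix (Fin 3) (Fin 2) E)).restrictScalars 𝒪[E]) ∧
                          (∀ c : E, (Pi.single 1 c : Fin 3 → E) ∈ L₃ ↔ Valued.v c ≤ Valued.v ϖ ^ b) ∧
                          (LatticeNearTransvShell ϖ (d % 2) (mstarOfRecord d) ((((endoGL (γ₂, u) : GL (Fin 3) E) : Matrix (Fin 3) (Fin 3) E) - 1)) L₃ ∧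
                            {z : E | ∃ y ∈ L₃, Valued.v ((ϖ ^ (mstarOfRecord d))⁻¹ * (z - pairing σ (!![H₂ 0 0, 0, H₂ 0 1; 0, hW, 0; H₂ 1 0, 0, H₂ 1 1] : Matrix (Fin 3) (Fin 3) E) y (((((endoGL (γ₂, u) : GL (Fin 3) E) : Matrix (Fin 3) (Fin 3) E) - 1)) *ᵥ y))) ≤ 1} =
                              valueSetMod σ ϖ (mstarOfRecord d) (xPlus σ ϖ d))}, f b j Λ : ℕ) : ℤ) -
      ((∑ᶠ Λ ∈ levelSetDep ρ Θ α (jE ϖ) h j b (lam - jE ((u : Matrix (Fin 1) (Fin 1) E) 0 0)) ∩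
                      {Λ | ∃ B : Submodule 𝒪[E] (Fin 2 → E), B.toAddSubgroup.map φ = Λ ∧
                        ∃ L₃ : Submodule 𝒪[E] (Fin 3 → E), IsSelfDualLattice σ ϖ (!![H₂ 0 0, 0, H₂ 0 1; 0, hW, 0; H₂ 1 0, 0, H₂ 1 1] : Matrix (Fin 3) (Fin 3) E) L₃ ∧
                          L₃ ⊓ LinearMap.ker ((LinearMap.proj (1 : Fin 3) : (Fin 3 → E) →ₗ[E] E).restrictScalars 𝒪[E]) =
                            B.map ((Matrix.toLin' (!![1, 0; 0, 0; 0, 1] : Matrix (Fin 3) (Fin 2) E)).restrictScalars 𝒪[E]) ∧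
                          (∀ c : E, (Pi.single 1 c : Fin 3 → E) ∈ L₃ ↔ Valued.v c ≤ Valued.v ϖ ^ b) ∧
                          (LatticeNearTransvShell ϖ (d % 2) (mcOfRecord d) ((((endoGL (γ₂, u) : GL (Fin 3) E) : Matrix (Fin 3) (Fin 3) E) - 1)) L₃ ∧
                            ¬ {z : E | ∃ y ∈ L₃, Valued.v ((ϖ ^ (mstarOfRecord d))⁻¹ * (z - pairing σ (!![H₂ 0 0, 0, H₂ 0 1; 0, hW, 0; H₂ 1 0, 0, H₂ 1 1] : Matrix (Fin 3) (Fin 3) E) y (((((endoGL (γ₂, u) : GL (Fin 3) E) : Matrix (Fin 3) (Fin 3) E) - 1)) *ᵥ y))) ≤ 1} =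
                              valueSetMod σ ϖ (mstarOfRecord d) (xPlus σ ϖ d))}, f b j Λ : ℕ) : ℤ) = 0 := by
  obtain ⟨hσ, hvσ, hϖ, hfix, hdd, h1d, ht⟩ := id hD
  have hϖle : Valued.v ϖ ≤ 1 := by rw [hϖ, ← exp_zero, exp_le_exp]; norm_num
  have hjϖ : Valued.v (jE ϖ) = exp (-2 : ℤ) := by rw [c1, hϖ, ← exp_nsmul]; congr 1
  have hjϖ0 : jE ϖ ≠ 0 := fun h0 => by rw [h0, map_zero] at hjϖ; exact (exp_ne_zero hjϖ.symm).elim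
  have hjϖle : Valued.v (jE ϖ) ≤ 1 := by rw [hjϖ, ← exp_zero, exp_le_exp]; norm_num
  have hPn : ∀ n : ℕ, Valued.v (jE ϖ) ^ n = exp (-(2 * (n : ℤ))) := fun n => by
    rw [hjϖ, ← exp_nsmul]; congr 1; simp only [nsmul_eq_mul]; ring
  -- `|α − ρα| = exp(−d_ρ)` from the RamM place package
  have hαρ : Valued.v (α - ρ α) = exp (-(dρ : ℤ)) := by rw [c6, c7.2.2.2.2.1, c5, ← exp_nsmul]; simp
  -- arithmetic of record
  have hdt : d ≤ tE + 1 := d_le_succ_t hσ hfix hϖ hdd ht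
  have harith : mcOfRecord d ≤ tE + mstarOfRecord d := by unfold mcOfRecord mstarOfRecord; omega
  -- the smallness `|ν| ≤ |ϖE|^(m_c)`: `|μ| = exp(−m) ≤ exp(−2m_c)` and `|jE(2(u₀₀ − 1))| = |2(u₀₀ − 1)|² ≤ |ϖ|^{2(tE + m⋆)} ≤ |jE ϖ|^{m_c}`
  have hν : Valued.v ((lam - 1) + (jE ((u : Matrix (Fin 1) (Fin 1) E) 0 0) - 1)) ≤ Valued.v (jE ϖ) ^ mcOfRecord d := by
    have e : (lam - 1) + (jE ((u : Matrix (Fin 1) (Fin 1) E) 0 0) - 1) =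
        (lam - jE ((u : Matrix (Fin 1) (Fin 1) E) 0 0)) + jE (2 * (((u : Matrix (Fin 1) (Fin 1) E) 0 0) - 1)) := by
      rw [map_mul, map_sub, map_one, map_ofNat]; ring
    rw [e]
    refine (Valuation.map_add _ _ _).trans (max_le ?_ ?_)
    · rw [hm, hPn, exp_le_exp]; omega
    · have hum' : Valued.v (((u : Matrix (Fin 1) (Fin 1) E) 0 0) - 1) ≤ Valued.v ϖ ^ mstarOfRecord d := by
        have h0 := hum
        rwa [map_pow] at h0
      have h2u1 : Valued.v (2 * (((u : Matrix (Fin 1) (Fin 1) E) 0 0) - 1)) ≤ Valued.v ϖ ^ (tE + mstarOfRecord d) := by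
        rw [map_mul, ht, pow_add]
        exact mul_le_mul' le_rfl hum'
      have h2u : Valued.v (jE (2 * (((u : Matrix (Fin 1) (Fin 1) E) 0 0) - 1))) ≤ Valued.v (jE ϖ) ^ (tE + mstarOfRecord d) := by
        rw [c1, c1, ← pow_mul, mul_comm 2 (tE + mstarOfRecord d), pow_mul, pow_two, pow_two]
        exact mul_le_mul' h2u1 h2u1
      exact h2u.trans (pow_le_pow_right_of_le_one' hjϖle harith)
  -- the order parameter `cc = ϖE^j`
  have hc : ρ (jE ϖ ^ j) = jE ϖ ^ j := by rw [← map_pow]; exact (hjfix _).2 ⟨ϖ ^ j, rfl⟩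
  have hc0 : jE ϖ ^ j ≠ 0 := pow_ne_zero j hjϖ0
  have hc1 : Valued.v (jE ϖ ^ j) ≤ 1 := by rw [map_pow]; exact pow_le_one₀ zero_le hjϖle
  -- the `+` subset is empty: (α′)₂ against the square digit at `k = m_c`
  have hplus : levelSetDep ρ Θ α (jE ϖ) h j b (lam - jE ((u : Matrix (Fin 1) (Fin 1) E) 0 0)) ∩
                      {Λ | ∃ B : Submodule 𝒪[E] (Fin 2 → E), B.toAddSubgroup.map φ = Λ ∧
                        ∃ L₃ : Submodule 𝒪[E] (Fin 3 → E), IsSelfDualLattice σ ϖ (!![H₂ 0 0, 0, H₂ 0 1; 0, hW, 0; H₂ 1 0, 0, H₂ 1 1] : Matrix (Fin 3) (Fin 3) E) L₃ ∧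
                          L₃ ⊓ LinearMap.ker ((LinearMap.proj (1 : Fin 3) : (Fin 3 → E) →ₗ[E] E).restrictScalars 𝒪[E]) =
                            B.map ((Matrix.toLin' (!![1, 0; 0, 0; 0, 1] : Matrix (Fin 3) (Fin 2) E)).restrictScalars 𝒪[E]) ∧
                          (∀ c : E, (Pi.single 1 c : Fin 3 → E) ∈ L₃ ↔ Valued.v c ≤ Valued.v ϖ ^ b) ∧
                          (LatticeNearTransvShell ϖ (d % 2) (mstarOfRecord d) ((((endoGL (γ₂, u) : GL (Fin 3) E) : Matrix (Fin 3) (Fin 3) E) - 1)) L₃ ∧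
                            {z : E | ∃ y ∈ L₃, Valued.v ((ϖ ^ (mstarOfRecord d))⁻¹ * (z - pairing σ (!![H₂ 0 0, 0, H₂ 0 1; 0, hW, 0; H₂ 1 0, 0, H₂ 1 1] : Matrix (Fin 3) (Fin 3) E) y (((((endoGL (γ₂, u) : GL (Fin 3) E) : Matrix (Fin 3) (Fin 3) E) - 1)) *ᵥ y))) ≤ 1} =
                              valueSetMod σ ϖ (mstarOfRecord d) (xPlus σ ϖ d))} = ∅ := by
    refine Set.subset_empty_iff.1 fun Λ hΛ => ?_
    obtain ⟨hΛ, B, hBΛ, L₃, hL, hLB, htube, hshell, hlab⟩ := hΛ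
    obtain ⟨x₀, w₀, g₀, hx₀, hΛx, -, -, hylev, hw₀Y, hpr, hg₀, hg₀1, hprg⟩ :=
      exists_presentation_of_mem_levelSetDep σ hσ hvσ hϖ hH₂ hH₂σ hhW jE hρρ hvρ hα hα1 hint hΘΘ hΘρ hvΘ hjv hjfix hjpow hϖmax φ hφs hφi hφo hφγ hlam hΘh hh hform
        ((u : Matrix (Fin 1) (Fin 1) E) 0 0) hb1 hlamj hΛ hBΛ hL hLB htube
    have hz : IsOrd ρ α (jE ϖ ^ j) ((lam - jE ((u : Matrix (Fin 1) (Fin 1) E) 0 0)) / dualGen ρ Θ α (jE ϖ ^ j) h x₀) :=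
      (forall_herm_mul_mem_iff_isOrd_div hρρ hvρ hα hα1 hint hΘΘ hΘρ hvΘ hc hc0 hc1 hh hx₀ hΛx _).1 ((mem_levelSetDep_iff ρ Θ α (jE ϖ) h j b _ Λ).1 hΛ).2
    -- Γ-fixedness from the level token of the shell
    obtain ⟨g, hLg, -⟩ := id hL
    have hfixL : mapGL (endoGL (γ₂, u)) L₃ = L₃ := by
      rw [hLg]
      refine mapGL_eq_of_latticeInLevel hϖle (v_det_endoGL_eq_one hvσ γ₂ u hdet hu) g (d % 2) ?_
      rw [← hLg]; exact hshell.1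
    -- (α′)₂: the `+` label on the `m*`-shell forces the square token at `m_c` … against the square digit
    have hsq := latticeInLevel_sq_endoGL_of_shell_of_valueSet_eq_of_formCongr hD P₁ hA γ₂ u hΓ hL hfixL hshell hlab hs hp
    exact not_latticeInLevel_sq_endoGL_sub_one_of_top_ramM hvρ hϖ jE hjϖ hjfix φ hφs hφi hφγ htube hpr hLB.symm hg₀ hg₀1 hprg hBΛ hx₀ hΛx hw₀Y hylev
      u hm hjl hαρ hz hν (by omega) hsq
  -- the `−′` subset is empty: the square digit at `k = m_c`
  have hminus : levelSetDep ρ Θ α (jE ϖ) h j b (lam - jE ((u : Matrix (Fin 1) (Fin 1) E) 0 0)) ∩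
                      {Λ | ∃ B : Submodule 𝒪[E] (Fin 2 → E), B.toAddSubgroup.map φ = Λ ∧
                        ∃ L₃ : Submodule 𝒪[E] (Fin 3 → E), IsSelfDualLattice σ ϖ (!![H₂ 0 0, 0, H₂ 0 1; 0, hW, 0; H₂ 1 0, 0, H₂ 1 1] : Matrix (Fin 3) (Fin 3) E) L₃ ∧
                          L₃ ⊓ LinearMap.ker ((LinearMap.proj (1 : Fin 3) : (Fin 3 → E) →ₗ[E] E).restrictScalars 𝒪[E]) =
                            B.map ((Matrix.toLin' (!![1, 0; 0, 0; 0, 1] : Matrix (Fin 3) (Fin 2) E)).restrictScalars 𝒪[E]) ∧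
                          (∀ c : E, (Pi.single 1 c : Fin 3 → E) ∈ L₃ ↔ Valued.v c ≤ Valued.v ϖ ^ b) ∧
                          (LatticeNearTransvShell ϖ (d % 2) (mcOfRecord d) ((((endoGL (γ₂, u) : GL (Fin 3) E) : Matrix (Fin 3) (Fin 3) E) - 1)) L₃ ∧
                            ¬ {z : E | ∃ y ∈ L₃, Valued.v ((ϖ ^ (mstarOfRecord d))⁻¹ * (z - pairing σ (!![H₂ 0 0, 0, H₂ 0 1; 0, hW, 0; H₂ 1 0, 0, H₂ 1 1] : Matrix (Fin 3) (Fin 3) E) y (((((endoGL (γ₂, u) : GL (Fin 3) E) : Matrix (Fin 3) (Fin 3) E) - 1)) *ᵥ y))) ≤ 1} =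
                              valueSetMod σ ϖ (mstarOfRecord d) (xPlus σ ϖ d))} = ∅ :=
    levelSetDep_inter_shell_eq_empty_of_top_ramM σ hσ hvσ hϖ hH₂ hH₂σ hhW jE hρρ hvρ hα hα1 hint hΘΘ hΘρ hvΘ hjv hjfix hjpow hϖmax hjϖ φ hφs hφi hφo hφγ hlam hΘh hh
      hform u hb1 hlamj hm hjl hαρ hν (by omega) (d % 2) _
  rw [hplus, hminus, finsum_mem_empty]
  simp

/-- **(U-mid)_C «A MIDDLE-BAND TOP-LINE CONE CELL OF THE RamM LEDGER CONTRIBUTES ZERO» — LH4-p12 (g8)'s `hTopC` letters POSITIONALLY, MID band** (after the context letters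
`hmcm`, `P₁ hA hΓ`, `hdet hu`, `hs hp`: `j b`, `1 ≤ b`, `b ≤ j`, `m < 4b`, `jl + 2b = 2j + d_ρ + m`, `2b + m⋆ ≤ m`, `m < 2b + m_c`, `lam ∈ 𝒪_j`; the three underscored ones are unused —
`cellDiff_top_eq_zero_ramM` does the work). [cite: Kottwitz1986BaseChangeUnits, §1 pp. 240–241] [cite: Rogawski1990, §4.9 Prop. 4.9.1 (b) p. 55] -/
theorem cellDiff_topMid_eq_zero_ramM
    (σ : E →+* E) {ϖ : E} {d tE : ℕ} (hD : IsRamifiedQuadraticDatum σ ϖ d tE)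
    {H₂ : Matrix (Fin 2) (Fin 2) E} (hH₂ : IsUnit H₂.det) (hH₂σ : (H₂.map σ)ᵀ = H₂) {hW : E} (hhW : Valued.v hW = 1)
    (jE : E →+* M) (hρρ : ∀ x, ρ (ρ x) = x) (hvρ : ∀ x, Valued.v (ρ x) = Valued.v x) (hα : ρ α ≠ α) (hα1 : Valued.v α ≤ 1)
    (hint : ∀ z : M, Valued.v z ≤ 1 → Valued.v ((z - ρ z) / (α - ρ α)) ≤ 1)
    (hΘΘ : ∀ x, Θ (Θ x) = x) (hΘρ : ∀ x, Θ (ρ x) = ρ (Θ x)) (hvΘ : ∀ x, Valued.v (Θ x) = Valued.v x)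
    (hjv : ∀ c, Valued.v (jE c) ≤ 1 ↔ Valued.v c ≤ 1) (hjfix : ∀ z, ρ z = z ↔ ∃ c, jE c = z)
    (hjpow : ∀ (t : E) (n : ℤ), Valued.v (jE t) = Valued.v (jE ϖ) ^ n ↔ Valued.v t = Valued.v ϖ ^ n)
    (hϖmax : ∀ t : M, ρ t = t → Valued.v t < 1 → Valued.v t ≤ Valued.v (jE ϖ))
    (c1 : ∀ a, Valued.v (jE a) = Valued.v a ^ 2) {ϖM : M} {dρ : ℕ} (c5 : Valued.v ϖM = WithZero.exp (-1 : ℤ)) (c6 : α - ρ α = ϖM - ρ ϖM)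
    (c7 : IsRamifiedQuadraticDatum ρ ϖM dρ (2 * tE))
    (φ : (Fin 2 → E) →+ M) (hφs : ∀ (c : E) (x : Fin 2 → E), φ (c • x) = jE c * φ x) (hφi : Function.Injective φ) (hφo : Function.Surjective φ)
    {γ₂ : GL (Fin 2) E} {lam h : M} (hφγ : ∀ x, φ ((γ₂ : Matrix (Fin 2) (Fin 2) E).mulVec x) = lam * φ x) (hlam : Valued.v lam = 1)
    (hΘh : Θ h = h) (hh : h ≠ 0) (hform : ∀ x y, jE (pairing σ H₂ x y) = h * Θ (φ x) * φ y + ρ (h * Θ (φ x) * φ y))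
    (u : GL (Fin 1) E) (hum : Valued.v (((u : Matrix (Fin 1) (Fin 1) E) 0 0) - 1) ≤ Valued.v (ϖ ^ mstarOfRecord d))
    {m jl : ℕ} (hm : Valued.v (lam - jE ((u : Matrix (Fin 1) (Fin 1) E) 0 0)) = WithZero.exp (-(m : ℤ)))
    (hjl : Valued.v ((lam - jE ((u : Matrix (Fin 1) (Fin 1) E) 0 0)) - ρ (lam - jE ((u : Matrix (Fin 1) (Fin 1) E) 0 0))) = WithZero.exp (-(jl : ℤ)))
    (f : ℕ → ℕ → AddSubgroup M → ℕ) (hmcm : 2 * mcOfRecord d ≤ m)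
    (P₁ : GL (Fin 3) E) (hA : formCongr σ P₁ ((StdForm.antidiagonal 3).over E) = (!![H₂ 0 0, 0, H₂ 0 1; 0, hW, 0; H₂ 1 0, 0, H₂ 1 1] : Matrix (Fin 3) (Fin 3) E))
    (hΓ : P₁ * endoGL (γ₂, u) * P₁⁻¹ ∈ unitaryGroupOfForm σ ((StdForm.antidiagonal 3).over E))
    (hdet : (γ₂ : Matrix (Fin 2) (Fin 2) E).det * σ (γ₂ : Matrix (Fin 2) (Fin 2) E).det = 1) (hu : Valued.v ((u : Matrix (Fin 1) (Fin 1) E) 0 0) = 1)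
    (hs : Valued.v ((γ₂ : Matrix (Fin 2) (Fin 2) E).trace - 2) * Valued.v (ϖ ^ (d % 2)) ≤ Valued.v (ϖ ^ mcOfRecord d))
    (hp : Valued.v ((γ₂ : Matrix (Fin 2) (Fin 2) E).det - (γ₂ : Matrix (Fin 2) (Fin 2) E).trace + 1) ≤ Valued.v (ϖ ^ mcOfRecord d))
    (j b : ℕ) (hb1 : 1 ≤ b) (_hbj : b ≤ j) (_h4b : m < 4 * b) (hline : jl + 2 * b = 2 * j + dρ + m)
    (_hband1 : 2 * b + mstarOfRecord d ≤ m) (hband2 : m < 2 * b + mcOfRecord d) (hlamj : IsOrd ρ α (jE ϖ ^ j) lam) :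
    ((∑ᶠ Λ ∈ levelSetDep ρ Θ α (jE ϖ) h j b (lam - jE ((u : Matrix (Fin 1) (Fin 1) E) 0 0)) ∩
                      {Λ | ∃ B : Submodule 𝒪[E] (Fin 2 → E), B.toAddSubgroup.map φ = Λ ∧
                        ∃ L₃ : Submodule 𝒪[E] (Fin 3 → E), IsSelfDualLattice σ ϖ (!![H₂ 0 0, 0, H₂ 0 1; 0, hW, 0; H₂ 1 0, 0, H₂ 1 1] : Matrix (Fin 3) (Fin 3) E) L₃ ∧
                          L₃ ⊓ LinearMap.ker ((LinearMap.proj (1 : Fin 3) : (Fin 3 → E) →ₗ[E] E).restrictScalars 𝒪[E]) =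
                            B.map ((Matrix.toLin' (!![1, 0; 0, 0; 0, 1] : Matrix (Fin 3) (Fin 2) E)).restrictScalars 𝒪[E]) ∧
                          (∀ c : E, (Pi.single 1 c : Fin 3 → E) ∈ L₃ ↔ Valued.v c ≤ Valued.v ϖ ^ b) ∧
                          (LatticeNearTransvShell ϖ (d % 2) (mstarOfRecord d) ((((endoGL (γ₂, u) : GL (Fin 3) E) : Matrix (Fin 3) (Fin 3) E) - 1)) L₃ ∧
                            {z : E | ∃ y ∈ L₃, Valued.v ((ϖ ^ (mstarOfRecord d))⁻¹ * (z - pairing σ (!![H₂ 0 0, 0, H₂ 0 1; 0, hW, 0; H₂ 1 0, 0, H₂ 1 1] : Matrix (Fin 3) (Fin 3) E) y (((((endoGL (γ₂, u) : GL (Fin 3) E) : Matrix (Fin 3) (Fin 3) E) - 1)) *ᵥ y))) ≤ 1} =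
                              valueSetMod σ ϖ (mstarOfRecord d) (xPlus σ ϖ d))}, f b j Λ : ℕ) : ℤ) -
      ((∑ᶠ Λ ∈ levelSetDep ρ Θ α (jE ϖ) h j b (lam - jE ((u : Matrix (Fin 1) (Fin 1) E) 0 0)) ∩
                      {Λ | ∃ B : Submodule 𝒪[E] (Fin 2 → E), B.toAddSubgroup.map φ = Λ ∧
                        ∃ L₃ : Submodule 𝒪[E] (Fin 3 → E), IsSelfDualLattice σ ϖ (!![H₂ 0 0, 0, H₂ 0 1; 0, hW, 0; H₂ 1 0, 0, H₂ 1 1] : Matrix (Fin 3) (Fin 3) E) L₃ ∧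
                          L₃ ⊓ LinearMap.ker ((LinearMap.proj (1 : Fin 3) : (Fin 3 → E) →ₗ[E] E).restrictScalars 𝒪[E]) =
                            B.map ((Matrix.toLin' (!![1, 0; 0, 0; 0, 1] : Matrix (Fin 3) (Fin 2) E)).restrictScalars 𝒪[E]) ∧
                          (∀ c : E, (Pi.single 1 c : Fin 3 → E) ∈ L₃ ↔ Valued.v c ≤ Valued.v ϖ ^ b) ∧
                          (LatticeNearTransvShell ϖ (d % 2) (mcOfRecord d) ((((endoGL (γ₂, u) : GL (Fin 3) E) : Matrix (Fin 3) (Fin 3) E) - 1)) L₃ ∧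
                            ¬ {z : E | ∃ y ∈ L₃, Valued.v ((ϖ ^ (mstarOfRecord d))⁻¹ * (z - pairing σ (!![H₂ 0 0, 0, H₂ 0 1; 0, hW, 0; H₂ 1 0, 0, H₂ 1 1] : Matrix (Fin 3) (Fin 3) E) y (((((endoGL (γ₂, u) : GL (Fin 3) E) : Matrix (Fin 3) (Fin 3) E) - 1)) *ᵥ y))) ≤ 1} =
                              valueSetMod σ ϖ (mstarOfRecord d) (xPlus σ ϖ d))}, f b j Λ : ℕ) : ℤ) = 0 :=
  cellDiff_top_eq_zero_ramM σ hD hH₂ hH₂σ hhW jE hρρ hvρ hα hα1 hint hΘΘ hΘρ hvΘ hjv hjfix hjpow hϖmax c1 c5 c6 c7 φ hφs hφi hφo hφγ hlam hΘh hh hform u hum hm hjl f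
    hmcm P₁ hA hΓ hdet hu hs hp j b hb1 hline hband2 hlamj

end Summit.HodgeConjecture.HodgeConjecture.Cruxes.H413.F0P3cDyRamTopConeCellMidRamM

end
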